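import Mathlib
import Summits.Langlands.Langlands.Theorems.IrreducibilityBySelfDualityHeckeEigenvalueFieldStubEndScalarAdelicA
import HarnessLib

/-!
# From a lifted family on `G_∞ × G(𝔸_f)` to the hypotheses of Borel's lemma on `GL_n(𝔸_K)`, II —
crux `HeckeEigenvalueField` (stmt-Langlands-13632), line `Sketch`, stub END-SCALAR, part ADELIC-B

Namespace `Summit.Langlands.Langlands.Theorems.HeckeEigenvalueField.Res`.  Theorems only; no
ResConeAnalytic preamble (as part ADELIC-A).

* `stub_endScalar_twist_scalar_cancel` (registered sub-stub) — `(t^{n[K:ℚ]})^s e^{-(log t) w} = 1` for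
  `s n[K:ℚ] = w`: the split centre `z(t) ∈ A_G` acts trivially on the twisted lift;
* `endScalar_adelic_package` — for `û(g, c) ∈ E_λ(ℂ)` smooth in the matrix coordinates of `g ∈ G_∞`
  (part SMOOTH), right invariant under the level, `GL_n(K)`-invariant, of weight `-w` under the split
  centre, and polynomially bounded in `H_∞(g)` together with its derivative along `g e^{tX}` coset by
  coset (part GROWTH), and `χ = |·|_𝔸^s` with `s n[K:ℚ] = w`, a linear functional `ℓ`: the function
  `F(x) = χ(det x) ℓ(û(x_∞, x_f))` on `GL_n(𝔸_K)` is left invariant under `A_G · GL_n(K)` (`|det γ|_𝔸 = 1`,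
  `|det z(t)|_𝔸^s = t^{n[K:ℚ]s}`), continuous (open level), smooth in the archimedean variable (`exp`
  real-analytic, the twist has differential `s λ`), of moderate growth in `H_∞` locally uniformly in `x_f`
  (`|χ(det x)| ≤ C (1 ⊔ ‖x‖)^k`, part ADELIC-A), and for `X` of norm exponent `λ(X) = 0` its Lie
  derivative `X F(x) = χ(det x) ℓ(d/dt|₀ û(x_∞ e^{tX}, x_f))` is continuous of the same growth — exactly
  the hypotheses of the tree's `integral_descend_lieDeriv_mul_conj_cuspFormsGL_eq_neg_of_archModerateGrowth`.

References: A. Borel, H. Jacquet, Corvallis (1979), §1.2, §4.1 and 5.7 [BorelJacquetCorvallis1979];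
A. Borel, N. Wallach (2000), VII 2.2 [BorelWallach2000]; G. Harder, Invent. Math. 89 (1987), §3.1
[Harder1987].
-/

set_option linter.dupNamespace false -- project-wide: `Summit.Langlands.Langlands` is the mandated namespace

noncomputable section

open scoped Classical Matrix Matrix.Norms.Operator Topology TensorProduct ContDiff NNReal
open Filter NumberField NumberField.mixedEmbedding IsDedekindDomain Literature.NumberTheory.Automorphic
open Literature.NumberTheory.Automorphic.RealMatrixGroup
open Literature.NumberTheory.GaloisRepresentations (HeckeCharacter ideleGroup ideleNorm)

namespace Summit.Langlands.Langlands.Theorems.HeckeEigenvalueField.Res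

variable {n : ℕ} {K : Type} [Field K] [NumberField K]

/-! ### The adelic package of a lifted family -/

/-- `(mk c').out` differs from `c'` by an element of the level, so level-invariant data agree. [folklore] -/
theorem apply_mk_out_eq {Y : Type*} {L : Subgroup (BigHeckeGLn.FiniteAdelicGL n K)} (f : BigHeckeGLn.FiniteAdelicGL n K → Y)
    (hf : ∀ c v, v ∈ L → f (c * v) = f c) (c' : BigHeckeGLn.FiniteAdelicGL n K) :
    f (QuotientGroup.mk c' : BigHeckeGLn.FiniteAdelicGL n K ⧸ L).out = f c' := by
  obtain ⟨v, hv⟩ := QuotientGroup.mk_out_eq_mul L c'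
  rw [hv, hf _ _ v.2]

/-- The scalar identity behind the `A_G`-invariance of the twisted lift:
`(t^{n[K:ℚ]})^s · e^{-(log t) w} = 1` when `s · n[K:ℚ] = w`. [folklore] -/
theorem stub_endScalar_twist_scalar_cancel {n : ℕ} {K : Type} [Field K] [NumberField K] {t : ℝ} (ht : 0 < t) {s w : ℝ} (hs : s * (n * Module.finrank ℚ K : ℕ) = w) :
    (((t ^ (n * Module.finrank ℚ K) : ℝ) : ℂ) ^ ((s : ℝ) : ℂ)) * (Real.exp (-(Real.log t * w)) : ℂ) = 1 := by
  have hpos : 0 < t ^ (n * Module.finrank ℚ K) := pow_pos ht _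
  rw [← Complex.ofReal_cpow hpos.le, Real.rpow_def_of_pos hpos, Real.log_pow, ← Complex.ofReal_mul,
    ← Real.exp_add, ← hs]
  have : (↑(n * Module.finrank ℚ K) : ℝ) * Real.log t * s + -(Real.log t * (s * ↑(n * Module.finrank ℚ K))) = 0 := by
    ring
  rw [this, Real.exp_zero, Complex.ofReal_one]

set_option maxHeartbeats 1600000 in
-- seven conclusions over the datum-typed lift; continuity/smoothness/growth each elaborate large terms
/-- **Stub END-SCALAR, part ADELIC — from a lifted family on `G_∞ × G(𝔸_f)` to the hypotheses of
Borel's lemma on `GL_n(𝔸_K)`.**  Let `û(g, c) ∈ E_λ(ℂ)` be smooth in the matrix coordinates of `g ∈ G_∞`,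
right invariant under the level in `c`, invariant under `GL_n(K)` acting diagonally, homogeneous of
weight `-w` under the split centre `exp(t · 1)`, and polynomially bounded in `H_∞(g)` together with its
derivative along `g e^{tX}`, coset by coset.  Then for `χ = |·|_𝔸^s` with `s · n[K:ℚ] = w` and a linear
functional `ℓ`, the function `F(x) = χ(det x) · ℓ(û(x_∞, x_f))` on `GL_n(𝔸_K)` is left invariant under
`A_G · GL_n(K)` (`|det γ|_𝔸 = 1`, `|det z(t)|_𝔸^s = t^{n[K:ℚ]s}`), continuous (the level is open: finitely
many cosets locally), smooth in the archimedean variable (`exp` is real-analytic; the twist has the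
differential `s λ`), of moderate growth in `H_∞` locally uniformly in `x_f` (`|χ(det x)| ≤ C (1 ⊔ ‖x‖)^k`
and the finite part of the height is bounded on compacts), and for `X` of norm exponent
`λ(X) = 0` its Lie derivative is `X F(x) = χ(det x) ℓ(d/dt|₀ û(x_∞ e^{tX}, x_f))`, again continuous and of
the same growth. [cite: BorelJacquetCorvallis1979, §1.2 and 5.7] [cite: BorelWallach2000, VII 2.2] -/
theorem endScalar_adelic_package {n : ℕ} {K : Type} [Field K] [NumberField K] [NeZero n]
    (hcpt : isCompact_glFiniteIntegralLevel n K) (𝔫 : Ideal (𝓞 K)) (lam : (K →+* ℂ) → Fin n → ℤ)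
    (uf : (AutomorphyDatum.gl n K hcpt).arch.carrier → BigHeckeGLn.FiniteAdelicGL n K →
      ResGLnCohomology.CoeffModule ℂ n K lam)
    (ℓ : ResGLnCohomology.CoeffModule ℂ n K lam →ₗ[ℂ] ℂ)
    (X : (AutomorphyDatum.gl n K hcpt).arch.lie)
    (hX : ((∑ w, (X : Matrix (Fin n) (Fin n) (mixedSpace K)).trace.1 w) +
      ∑ w, 2 * ((X : Matrix (Fin n) (Fin n) (mixedSpace K)).trace.2 w).re) = 0)
    (hsm : ∀ (c : BigHeckeGLn.FiniteAdelicGL n K) (m₀ : Matrix (Fin n) (Fin n) (mixedSpace K)), IsUnit m₀ →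
      ContDiffAt ℝ ∞ (fun m : Matrix (Fin n) (Fin n) (mixedSpace K) => uf (GLn.archOfMatrix n K m) c) m₀)
    (hlv : ∀ (g : (AutomorphyDatum.gl n K hcpt).arch.carrier) (c v : BigHeckeGLn.FiniteAdelicGL n K),
      v ∈ ResGLnCohomology.level n K 𝔫 → uf g (c * v) = uf g c)
    (hK : ∀ (γ : GL (Fin n) K) (g : (AutomorphyDatum.gl n K hcpt).arch.carrier) (c : BigHeckeGLn.FiniteAdelicGL n K),
      uf ((show (AutomorphyDatum.gl n K hcpt).arch.carrier from ParallelWeight.diagArch K n γ) * g)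
        (BigHeckeGLn.globalEmbedding n K γ * c) = uf g c)
    {w : ℝ}
    (hA : ∀ (t : ℝ) (g : (AutomorphyDatum.gl n K hcpt).arch.carrier) (c : BigHeckeGLn.FiniteAdelicGL n K),
      uf (g * (AutomorphyDatum.gl n K hcpt).arch.expMem
        (t • (⟨1, trivial⟩ : (AutomorphyDatum.gl n K hcpt).arch.lie))) c = (Real.exp (-(t * w)) : ℂ) • uf g c)
    (hgr : ∀ c : BigHeckeGLn.FiniteAdelicGL n K ⧸ ResGLnCohomology.level n K 𝔫, ∃ (A : ℝ) (r : ℕ),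
      ∀ (g : (AutomorphyDatum.gl n K hcpt).arch.carrier) (c' : BigHeckeGLn.FiniteAdelicGL n K),
        (c' : BigHeckeGLn.FiniteAdelicGL n K ⧸ ResGLnCohomology.level n K 𝔫) = c →
        ‖uf g c'‖ ≤ A * (1 ⊔ (GLn.archHeight n K ((AutomorphyDatum.gl n K hcpt).ofArch g) : ℝ)) ^ r ∧
        ‖deriv (fun t : ℝ => uf (g * (AutomorphyDatum.gl n K hcpt).arch.expMem (t • X)) c') 0‖ ≤
          A * (1 ⊔ (GLn.archHeight n K ((AutomorphyDatum.gl n K hcpt).ofArch g) : ℝ)) ^ r)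
    (χ : HeckeCharacter K) {s : ℝ}
    (hχ : ∀ x : ideleGroup K, ((χ x : ℂˣ) : ℂ) = (ideleNorm x : ℂ) ^ ((s : ℝ) : ℂ))
    (hs : s * (n * Module.finrank ℚ K : ℕ) = w) :
    (∀ γ ∈ (AdelicGroupData.gl n K).quotientSubgroup, ∀ a : (AdelicGroupData.gl n K).Adelic,
      (fun a : (AdelicGroupData.gl n K).Adelic => ((detTwist n χ a : ℂˣ) : ℂ) * ℓ (uf ⟨GLn.toMixed n K a, Subgroup.mem_top _⟩ (GLn.sndHom n K a))) (γ * a) =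
        (fun a : (AdelicGroupData.gl n K).Adelic => ((detTwist n χ a : ℂˣ) : ℂ) * ℓ (uf ⟨GLn.toMixed n K a, Subgroup.mem_top _⟩ (GLn.sndHom n K a))) a) ∧
    Continuous (fun a : (AdelicGroupData.gl n K).Adelic => ((detTwist n χ a : ℂˣ) : ℂ) * ℓ (uf ⟨GLn.toMixed n K a, Subgroup.mem_top _⟩ (GLn.sndHom n K a))) ∧
    IsArchSmooth (AutomorphyDatum.gl n K hcpt).ofArch (fun a : (AdelicGroupData.gl n K).Adelic => ((detTwist n χ a : ℂˣ) : ℂ) * ℓ (uf ⟨GLn.toMixed n K a, Subgroup.mem_top _⟩ (GLn.sndHom n K a))) ∧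
    (∀ C : Set (GL (Fin n) (FiniteAdeleRing (𝓞 K) K)), IsCompact C →
      ∃ (A : ℝ) (r : ℕ), ∀ a : (AdelicGroupData.gl n K).Adelic, GLn.sndHom n K a ∈ C →
        ‖(fun a : (AdelicGroupData.gl n K).Adelic => ((detTwist n χ a : ℂˣ) : ℂ) * ℓ (uf ⟨GLn.toMixed n K a, Subgroup.mem_top _⟩ (GLn.sndHom n K a))) a‖ ≤ A * (1 ⊔ (GLn.archHeight n K a : ℝ)) ^ r) ∧
    (lieDeriv (AutomorphyDatum.gl n K hcpt).ofArch X (fun a : (AdelicGroupData.gl n K).Adelic => ((detTwist n χ a : ℂˣ) : ℂ) * ℓ (uf ⟨GLn.toMixed n K a, Subgroup.mem_top _⟩ (GLn.sndHom n K a))) =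
      fun a : (AdelicGroupData.gl n K).Adelic => ((detTwist n χ a : ℂˣ) : ℂ) *
        ℓ (deriv (fun t : ℝ => uf ((⟨GLn.toMixed n K a, Subgroup.mem_top _⟩ :
          (AutomorphyDatum.gl n K hcpt).arch.carrier) * (AutomorphyDatum.gl n K hcpt).arch.expMem (t • X))
          (GLn.sndHom n K a)) 0)) ∧
    Continuous (lieDeriv (AutomorphyDatum.gl n K hcpt).ofArch X (fun a : (AdelicGroupData.gl n K).Adelic => ((detTwist n χ a : ℂˣ) : ℂ) * ℓ (uf ⟨GLn.toMixed n K a, Subgroup.mem_top _⟩ (GLn.sndHom n K a)))) ∧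
    (∀ C : Set (GL (Fin n) (FiniteAdeleRing (𝓞 K) K)), IsCompact C →
      ∃ (A : ℝ) (r : ℕ), ∀ a : (AdelicGroupData.gl n K).Adelic, GLn.sndHom n K a ∈ C →
        ‖lieDeriv (AutomorphyDatum.gl n K hcpt).ofArch X (fun a : (AdelicGroupData.gl n K).Adelic => ((detTwist n χ a : ℂˣ) : ℂ) * ℓ (uf ⟨GLn.toMixed n K a, Subgroup.mem_top _⟩ (GLn.sndHom n K a))) a‖ ≤
          A * (1 ⊔ (GLn.archHeight n K a : ℝ)) ^ r) := by
  haveI : FiniteDimensional ℝ (mixedSpace K) := inferInstance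
  -- Mathlib idiom (Mathlib/Algebra/Lie/OfAssociative.lean): the commutator Lie ring on matrices, to name `𝔤.toSubmodule`
  letI : LieRing (Matrix (Fin n) (Fin n) (mixedSpace K)) := LieRing.ofAssociativeRing
  -- the untwisted coordinate `φ₀` and the twist
  set φ₀ : (AdelicGroupData.gl n K).Adelic → ℂ := fun a =>
    ℓ (uf ⟨GLn.toMixed n K a, Subgroup.mem_top _⟩ (GLn.sndHom n K a)) with hφ₀
  have hF : (fun a : (AdelicGroupData.gl n K).Adelic => ((detTwist n χ a : ℂˣ) : ℂ) * ℓ (uf ⟨GLn.toMixed n K a, Subgroup.mem_top _⟩ (GLn.sndHom n K a))) = mulChar (detTwist n χ) φ₀ := rfl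
  rw [hF]
  set L := LinearMap.toContinuousLinearMap ℓ with hL
  have hLℓ : ∀ e, L e = ℓ e := fun e => rfl
  set Lr : ResGLnCohomology.CoeffModule ℂ n K lam →L[ℝ] ℂ := L.restrictScalars ℝ with hLr
  have hout : ∀ (g : (AutomorphyDatum.gl n K hcpt).arch.carrier) (c' : BigHeckeGLn.FiniteAdelicGL n K),
      uf g (QuotientGroup.mk c' : BigHeckeGLn.FiniteAdelicGL n K ⧸ ResGLnCohomology.level n K 𝔫).out = uf g c' :=
    fun g c' => apply_mk_out_eq (uf g) (hlv g) c'
  -- (1) invariance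
  have hinv : ∀ γ ∈ (AdelicGroupData.gl n K).quotientSubgroup, ∀ a,
      mulChar (detTwist n χ) φ₀ (γ * a) = mulChar (detTwist n χ) φ₀ a := by
    refine (AdelicGroupData.gl n K).leftInvariant_quotientSubgroup ?_ ?_
    · intro γ hγ a
      have h1 : detTwist n χ γ = 1 := detTwist_eq_one_of_mem_arithmeticSubgroup n χ hγ
      obtain ⟨γ₀, rfl⟩ := hγ
      rw [mulChar_apply, mulChar_apply, map_mul, h1, one_mul]
      simp only [hφ₀]
      rw [archPt_mul, archPt_toAdelic, GLn.sndHom_mul_adelic, sndHom_toAdelic, hK]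
    · rintro _ ⟨t, rfl⟩ a
      have ht : (0 : ℝ) < ((t : ℝ≥0) : ℝ) := NNReal.coe_pos.2 (pos_iff_ne_zero.2 t.ne_zero)
      rw [mulChar_apply, mulChar_apply, map_mul, Units.val_mul, detTwist_posRealScalar_of_cpow hχ]
      simp only [hφ₀]
      rw [archPt_mul, archPt_posRealScalar, GLn.sndHom_mul_adelic, GLn.sndHom_posRealScalar, one_mul]
      have hcomm : (AutomorphyDatum.gl n K hcpt).arch.expMem
            ((Real.log ((t : ℝ≥0) : ℝ)) • (⟨1, trivial⟩ : (AutomorphyDatum.gl n K hcpt).arch.lie)) *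
          (⟨GLn.toMixed n K a, Subgroup.mem_top _⟩ : (AutomorphyDatum.gl n K hcpt).arch.carrier) =
          (⟨GLn.toMixed n K a, Subgroup.mem_top _⟩ : (AutomorphyDatum.gl n K hcpt).arch.carrier) *
            (AutomorphyDatum.gl n K hcpt).arch.expMem
              ((Real.log ((t : ℝ≥0) : ℝ)) • (⟨1, trivial⟩ : (AutomorphyDatum.gl n K hcpt).arch.lie)) :=
        Subtype.ext (expMem_smul_one_mul_comm _ _)
      rw [hcomm, hA, map_smul, smul_eq_mul]
      have hsc := stub_endScalar_twist_scalar_cancel (n := n) (K := K) ht hs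
      calc _ = ((((((t : ℝ≥0) : ℝ) ^ (n * Module.finrank ℚ K) : ℝ) : ℂ) ^ ((s : ℝ) : ℂ)) *
            (Real.exp (-(Real.log ((t : ℝ≥0) : ℝ) * w)) : ℂ)) *
            (((detTwist n χ a : ℂˣ) : ℂ) * ℓ (uf ⟨GLn.toMixed n K a, Subgroup.mem_top _⟩ (GLn.sndHom n K a))) := by
            ring
        _ = _ := by rw [hsc, one_mul]
  -- (2) continuity of `g ↦ û(g, c)` and of `φ₀`
  have hcoe : Continuous fun g : (AutomorphyDatum.gl n K hcpt).arch.carrier =>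
      ((g : GL (Fin n) (mixedSpace K)) : Matrix (Fin n) (Fin n) (mixedSpace K)) :=
    Units.continuous_val.comp continuous_subtype_val
  have hcu : ∀ c' : BigHeckeGLn.FiniteAdelicGL n K, Continuous fun g : (AutomorphyDatum.gl n K hcpt).arch.carrier => uf g c' := by
    intro c'
    refine continuous_iff_continuousAt.2 fun g => ?_
    have h := ((hsm c' _ (Units.isUnit (g : GL (Fin n) (mixedSpace K)))).continuousAt).comp
      (f := fun g' : (AutomorphyDatum.gl n K hcpt).arch.carrier =>
        ((g' : GL (Fin n) (mixedSpace K)) : Matrix (Fin n) (Fin n) (mixedSpace K))) (x := g) hcoe.continuousAt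
    refine h.congr (Eventually.of_forall fun g' => ?_)
    change uf (GLn.archOfMatrix n K _) c' = uf g' c'
    rw [ConeDictionary.archOfMatrix_coe_datum]
  have hφ₀c : Continuous φ₀ := by
    have h := continuous_of_coset' hcpt (isOpen_level' 𝔫)
      (fun g (q : BigHeckeGLn.FiniteAdelicGL n K ⧸ ResGLnCohomology.level n K 𝔫) => ℓ (uf g q.out))
      (fun q => L.continuous.comp (hcu q.out))
    refine h.congr fun a => ?_
    change ℓ (uf _ _) = ℓ (uf _ _)
    rw [hout]
  have hFc : Continuous (mulChar (detTwist n χ) φ₀) := by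
    have : mulChar (detTwist n χ) φ₀ = fun a => ((detTwist n χ a : ℂˣ) : ℂ) * φ₀ a := rfl
    rw [this]
    exact (Units.continuous_val.comp (continuous_detTwist (n := n) χ)).mul hφ₀c
  -- (3) smoothness in the archimedean variable
  obtain ⟨lamN, -, hlamN⟩ := exists_normExponent (n := n) (K := K) hcpt
  have hδ := detTwist_ofArch_expMem_eq_exp_smul (hcpt := hcpt) hχ hlamN
  have hexp : ContDiff ℝ ∞ fun Y : Matrix (Fin n) (Fin n) (mixedSpace K) => NormedSpace.exp Y :=
    contDiff_iff_contDiffAt.2 fun Y => (NormedSpace.exp_analytic Y).contDiffAt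
  have hsm₀ : IsArchSmooth (AutomorphyDatum.gl n K hcpt).ofArch φ₀ := by
    intro a
    set g : (AutomorphyDatum.gl n K hcpt).arch.carrier := ⟨GLn.toMixed n K a, Subgroup.mem_top _⟩ with hg
    have hin : ContDiff ℝ ∞ fun Y : (AutomorphyDatum.gl n K hcpt).arch.lie.toSubmodule =>
        ((g : GL (Fin n) (mixedSpace K)) : Matrix (Fin n) (Fin n) (mixedSpace K)) *
          NormedSpace.exp (Y : Matrix (Fin n) (Fin n) (mixedSpace K)) :=
      contDiff_const.mul (hexp.comp (AutomorphyDatum.gl n K hcpt).arch.lie.toSubmodule.subtypeL.contDiff)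
    have heq : (fun Y : (AutomorphyDatum.gl n K hcpt).arch.lie.toSubmodule =>
        φ₀ (a * (AutomorphyDatum.gl n K hcpt).ofArch ((AutomorphyDatum.gl n K hcpt).arch.expMem ⟨Y, Y.2⟩))) =
        (fun m : Matrix (Fin n) (Fin n) (mixedSpace K) => ℓ (uf (GLn.archOfMatrix n K m) (GLn.sndHom n K a))) ∘
          fun Y : (AutomorphyDatum.gl n K hcpt).arch.lie.toSubmodule =>
            ((g : GL (Fin n) (mixedSpace K)) : Matrix (Fin n) (Fin n) (mixedSpace K)) *
              NormedSpace.exp (Y : Matrix (Fin n) (Fin n) (mixedSpace K)) := by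
      funext Y
      have hpt : g * (AutomorphyDatum.gl n K hcpt).arch.expMem ⟨Y, Y.2⟩ =
          GLn.archOfMatrix n K (((g : GL (Fin n) (mixedSpace K)) : Matrix (Fin n) (Fin n) (mixedSpace K)) *
            NormedSpace.exp (Y : Matrix (Fin n) (Fin n) (mixedSpace K))) := by
        have h1 := ConeDictionary.archOfMatrix_coe_datum (hcpt := hcpt) (g * (AutomorphyDatum.gl n K hcpt).arch.expMem ⟨Y, Y.2⟩)
        rw [← h1]
        congr 1
      simp only [Function.comp_apply, hφ₀]
      rw [archPt_mul, archPt_ofArch, sndHom_mul_ofArch, ← hg, hpt]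
    rw [heq]
    refine contDiff_iff_contDiffAt.2 fun Y => ?_
    have hunit : IsUnit (((g : GL (Fin n) (mixedSpace K)) : Matrix (Fin n) (Fin n) (mixedSpace K)) *
        NormedSpace.exp (Y : Matrix (Fin n) (Fin n) (mixedSpace K))) :=
      (Units.isUnit _).mul (Matrix.isUnit_exp _)
    exact ((Lr.contDiff.contDiffAt).comp _ (hsm (GLn.sndHom n K a) _ hunit)).comp Y hin.contDiffAt
  have hFs : IsArchSmooth (AutomorphyDatum.gl n K hcpt).ofArch (mulChar (detTwist n χ) φ₀) :=
    isArchSmooth_mulChar_of_exp _ hδ hsm₀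
  -- (4) growth
  obtain ⟨C₀, k₀, hC₀, hdet⟩ := exists_norm_detTwist_le' (n := n) hχ
  choose Ac rc hAc using hgr
  have hgF : ∀ C : Set (GL (Fin n) (FiniteAdeleRing (𝓞 K) K)), IsCompact C →
      ∃ (A : ℝ) (r : ℕ), ∀ a : (AdelicGroupData.gl n K).Adelic, GLn.sndHom n K a ∈ C →
        ‖mulChar (detTwist n χ) φ₀ a‖ ≤ A * (1 ⊔ (GLn.archHeight n K a : ℝ)) ^ r := by
    refine stub_endScalar_archGrowth_of_coset_bound (isOpen_level' 𝔫) (fun q => C₀ * (‖L‖ * max (Ac q) 0)) rc k₀ fun x => ?_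
    have h3 := (hAc _ ⟨GLn.toMixed n K x, Subgroup.mem_top _⟩ (GLn.sndHom n K x) rfl).1
    rw [archHeight_ofArch_archPt] at h3
    have h0 : 0 ≤ (1 ⊔ (GLn.archHeight n K x : ℝ)) := zero_le_one.trans le_sup_left
    rw [mulChar_apply, norm_mul]
    calc _ ≤ (C₀ * (1 ⊔ adelicHeightGL n K x) ^ k₀) *
          (‖L‖ * (max (Ac (QuotientGroup.mk (GLn.sndHom n K x))) 0 * (1 ⊔ (GLn.archHeight n K x : ℝ)) ^
            rc (QuotientGroup.mk (GLn.sndHom n K x)))) :=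
          mul_le_mul (hdet x) ((L.le_opNorm _).trans (mul_le_mul_of_nonneg_left
            (h3.trans (mul_le_mul_of_nonneg_right (le_max_left _ _) (pow_nonneg h0 _))) (norm_nonneg _)))
            (norm_nonneg _) (mul_nonneg hC₀ (pow_nonneg (zero_le_one.trans le_sup_left) _))
      _ = _ := by ring
  -- (5) the Lie derivative
  have hcurve : ∀ a : (AdelicGroupData.gl n K).Adelic, HasDerivAt
      (fun t : ℝ => uf ((⟨GLn.toMixed n K a, Subgroup.mem_top _⟩ : (AutomorphyDatum.gl n K hcpt).arch.carrier) *
        (AutomorphyDatum.gl n K hcpt).arch.expMem (t • X)) (GLn.sndHom n K a))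
      (fderiv ℝ (fun m : Matrix (Fin n) (Fin n) (mixedSpace K) => uf (GLn.archOfMatrix n K m) (GLn.sndHom n K a))
        ((GLn.toMixed n K a : GL (Fin n) (mixedSpace K)) : Matrix (Fin n) (Fin n) (mixedSpace K))
        (((GLn.toMixed n K a : GL (Fin n) (mixedSpace K)) : Matrix (Fin n) (Fin n) (mixedSpace K)) *
          (X : Matrix (Fin n) (Fin n) (mixedSpace K)))) 0 :=
    fun a => hasDerivAt_mul_expMem_of_matrix hcpt (fun g => uf g (GLn.sndHom n K a)) _ X
      ((hsm (GLn.sndHom n K a) _ (Units.isUnit _)).differentiableAt (by simp))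
  have hlie₀ : ∀ a : (AdelicGroupData.gl n K).Adelic, lieDeriv (AutomorphyDatum.gl n K hcpt).ofArch X φ₀ a =
      ℓ (deriv (fun t : ℝ => uf ((⟨GLn.toMixed n K a, Subgroup.mem_top _⟩ :
        (AutomorphyDatum.gl n K hcpt).arch.carrier) * (AutomorphyDatum.gl n K hcpt).arch.expMem (t • X))
          (GLn.sndHom n K a)) 0) := by
    intro a
    rw [(hcurve a).deriv]
    have h := Lr.hasFDerivAt.comp_hasDerivAt 0 (hcurve a)
    have h' : HasDerivAt (fun t : ℝ => φ₀ (a * (AutomorphyDatum.gl n K hcpt).ofArch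
        ((AutomorphyDatum.gl n K hcpt).arch.expMem (t • X)))) (Lr (fderiv ℝ
          (fun m : Matrix (Fin n) (Fin n) (mixedSpace K) => uf (GLn.archOfMatrix n K m) (GLn.sndHom n K a))
          ((GLn.toMixed n K a : GL (Fin n) (mixedSpace K)) : Matrix (Fin n) (Fin n) (mixedSpace K))
          (((GLn.toMixed n K a : GL (Fin n) (mixedSpace K)) : Matrix (Fin n) (Fin n) (mixedSpace K)) *
            (X : Matrix (Fin n) (Fin n) (mixedSpace K))))) 0 := by
      refine h.congr_of_eventuallyEq (Eventually.of_forall fun t => ?_)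
      simp only [Function.comp_apply, hφ₀]
      rw [archPt_mul, archPt_ofArch, sndHom_mul_ofArch]
      rfl
    exact h'.deriv
  have hδX : (((s : ℝ) : ℂ) • (Complex.ofRealAm.toLinearMap.comp lamN)) X = 0 := by
    rw [LinearMap.smul_apply, LinearMap.comp_apply, hlamN X, hX]
    simp
  have hlieF : lieDeriv (AutomorphyDatum.gl n K hcpt).ofArch X (mulChar (detTwist n χ) φ₀) =
      fun a : (AdelicGroupData.gl n K).Adelic => ((detTwist n χ a : ℂˣ) : ℂ) *
        ℓ (deriv (fun t : ℝ => uf ((⟨GLn.toMixed n K a, Subgroup.mem_top _⟩ :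
          (AutomorphyDatum.gl n K hcpt).arch.carrier) * (AutomorphyDatum.gl n K hcpt).arch.expMem (t • X))
          (GLn.sndHom n K a)) 0) := by
    rw [lieDeriv_mulChar_of_exp _ hδ X hsm₀, hδX, zero_smul, add_zero]
    funext a
    rw [mulChar_apply, hlie₀]
  -- (6) continuity of the Lie derivative
  have hfdc : ∀ c' : BigHeckeGLn.FiniteAdelicGL n K, Continuous fun g : (AutomorphyDatum.gl n K hcpt).arch.carrier =>
      fderiv ℝ (fun m : Matrix (Fin n) (Fin n) (mixedSpace K) => uf (GLn.archOfMatrix n K m) c')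
        ((g : GL (Fin n) (mixedSpace K)) : Matrix (Fin n) (Fin n) (mixedSpace K))
        (((g : GL (Fin n) (mixedSpace K)) : Matrix (Fin n) (Fin n) (mixedSpace K)) *
          (X : Matrix (Fin n) (Fin n) (mixedSpace K))) := by
    intro c'
    refine continuous_iff_continuousAt.2 fun g => ?_
    have h1 : ContinuousAt (fderiv ℝ (fun m : Matrix (Fin n) (Fin n) (mixedSpace K) => uf (GLn.archOfMatrix n K m) c'))
        ((g : GL (Fin n) (mixedSpace K)) : Matrix (Fin n) (Fin n) (mixedSpace K)) :=
      ((hsm c' _ (Units.isUnit (g : GL (Fin n) (mixedSpace K)))).fderiv_right (m := 0) (by simp)).continuousAt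
    exact (h1.comp (f := fun g' : (AutomorphyDatum.gl n K hcpt).arch.carrier =>
      ((g' : GL (Fin n) (mixedSpace K)) : Matrix (Fin n) (Fin n) (mixedSpace K))) (x := g)
      hcoe.continuousAt).clm_apply (hcoe.continuousAt.mul continuousAt_const)
  have hXc : Continuous (lieDeriv (AutomorphyDatum.gl n K hcpt).ofArch X (mulChar (detTwist n χ) φ₀)) := by
    rw [hlieF]
    refine (Units.continuous_val.comp (continuous_detTwist (n := n) χ)).mul ?_
    have h := continuous_of_coset' hcpt (isOpen_level' 𝔫)
      (fun g (q : BigHeckeGLn.FiniteAdelicGL n K ⧸ ResGLnCohomology.level n K 𝔫) =>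
        ℓ (fderiv ℝ (fun m : Matrix (Fin n) (Fin n) (mixedSpace K) => uf (GLn.archOfMatrix n K m) q.out)
          ((g : GL (Fin n) (mixedSpace K)) : Matrix (Fin n) (Fin n) (mixedSpace K))
          (((g : GL (Fin n) (mixedSpace K)) : Matrix (Fin n) (Fin n) (mixedSpace K)) *
            (X : Matrix (Fin n) (Fin n) (mixedSpace K)))))
      (fun q => L.continuous.comp (hfdc q.out))
    refine h.congr fun a => ?_
    rw [(hcurve a).deriv]
    have hfun : (fun m : Matrix (Fin n) (Fin n) (mixedSpace K) => uf (GLn.archOfMatrix n K m)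
        (QuotientGroup.mk (GLn.sndHom n K a) : BigHeckeGLn.FiniteAdelicGL n K ⧸ ResGLnCohomology.level n K 𝔫).out) =
        fun m => uf (GLn.archOfMatrix n K m) (GLn.sndHom n K a) := funext fun m => hout _ _
    rw [hfun]
  -- (7) growth of the Lie derivative
  have hgX : ∀ C : Set (GL (Fin n) (FiniteAdeleRing (𝓞 K) K)), IsCompact C →
      ∃ (A : ℝ) (r : ℕ), ∀ a : (AdelicGroupData.gl n K).Adelic, GLn.sndHom n K a ∈ C →
        ‖lieDeriv (AutomorphyDatum.gl n K hcpt).ofArch X (mulChar (detTwist n χ) φ₀) a‖ ≤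
          A * (1 ⊔ (GLn.archHeight n K a : ℝ)) ^ r := by
    rw [hlieF]
    refine stub_endScalar_archGrowth_of_coset_bound (isOpen_level' 𝔫) (fun q => C₀ * (‖L‖ * max (Ac q) 0)) rc k₀ fun x => ?_
    have h3 := (hAc _ ⟨GLn.toMixed n K x, Subgroup.mem_top _⟩ (GLn.sndHom n K x) rfl).2
    rw [archHeight_ofArch_archPt] at h3
    have h0 : 0 ≤ (1 ⊔ (GLn.archHeight n K x : ℝ)) := zero_le_one.trans le_sup_left
    rw [norm_mul]
    calc _ ≤ (C₀ * (1 ⊔ adelicHeightGL n K x) ^ k₀) *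
          (‖L‖ * (max (Ac (QuotientGroup.mk (GLn.sndHom n K x))) 0 * (1 ⊔ (GLn.archHeight n K x : ℝ)) ^
            rc (QuotientGroup.mk (GLn.sndHom n K x)))) :=
          mul_le_mul (hdet x) ((L.le_opNorm _).trans (mul_le_mul_of_nonneg_left
            (h3.trans (mul_le_mul_of_nonneg_right (le_max_left _ _) (pow_nonneg h0 _))) (norm_nonneg _)))
            (norm_nonneg _) (mul_nonneg hC₀ (pow_nonneg (zero_le_one.trans le_sup_left) _))
      _ = _ := by ring
  exact ⟨hinv, hFc, hFs, hgF, hlieF, hXc, hgX⟩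

end Summit.Langlands.Langlands.Theorems.HeckeEigenvalueField.Res

end
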